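/-
Copyright (c) 2026 the pub-hodgecm-mathlib formalisation cell (harness21).  Prover seat hodgecm-mathlib-K2E3-p21 (g4), Track B «K2-LIT» ∕ h413
(`stmt-HodgeConjecture-24833`), line `K2_E3_EllipticInputs`, unit U12 §L, kernel road «RICHARDSON» for (L-B_GL) at `N = 3` (road owner K2E3-p11 (g4), deal
2026-09-04T04:19Z), brick (R1b) «ORBIT SPACES OF THE TWO NON-ZERO NILPOTENT ORBITS OF 𝔤𝔩₃(F)»; §1 typed by K2E3-p11 (g4) (`K2E3GL3NilpotentOrbits.sec5`).  2026-09-04.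
-/
import Summits.HodgeConjecture.HodgeConjecture.Theorems.K2E3GL3NilpotentOrbits   -- ★ R1a p857297 (K2E3-p11 g4): the orbits as sets, trichotomy
import Literature.NumberTheory.GaloisRepresentations.LocalField                  -- ★ `isLocalField` (T2 ∕ locally compact `F`)
import Mathlib.MeasureTheory.Group.Action
import Mathlib.MeasureTheory.Integral.Bochner.Set
import Mathlib.MeasureTheory.Constructions.BorelSpace.Basic
import Mathlib.Topology.LocallyClosed
import HarnessLib

/-!
# K2_E3 road (h413), §L — kernel road «RICHARDSON» for (L-B_GL) at `N = 3`, brick (R1b): the regular and the minimal nilpotent orbits of `𝔤𝔩₃(F)` as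
# homogeneous `ConjAct GL₃(F)`-spaces, and the docking of an ambient `Ad`-invariant Radon measure on them

Cell `pub/hodgecm-mathlib` (D-0151), Track B, seat K2E3-p21 (g4); road owner K2E3-p11 (g4) (MEMO «ROW 11 — SPLIT ROAD» v1 §4, deal 2026-09-04T04:19Z), §L lead
K2E3-p12 (g4), dealer K2E3-plan (g3).  `--supports stmt-HodgeConjecture-24833 --as helper`; THEOREMS ONLY (no definition ∕ instance ∕ notation ∕ named fact ∕ `sorry`);
never imports `Cruxes/…/Lines`.  COUNT-NEUTRAL ((L-B_GL) ∕ (LBGL-ge3) stay OPEN).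

Purpose.  The `𝔤𝔩₃` twin of ★ S2b `K2E3GL2RegularNilpotentOrbitSpace`: the input that the one-orbit uniqueness theorem ★ COINV-1
(`Literature.MeasureTheory.Group.exists_forall_apply_eq_const_mul_integral_of_smul_invariant_of_additive`) wants, for EACH of the two non-zero nilpotent orbits
`Ad·J` (`J = E₁₂ + E₂₃`, regular) and `Ad·E` (`E = E₁₃`, minimal) of ★ R1a, with `G₃ := ConjAct (GL (Fin 3) F)` acting on `𝔤 := Matrix (Fin 3) (Fin 3) F` by
`g • X = g X g⁻¹`.  Consumed by (R1c) `K2E3GL3NilpotentOrbitUniqueness` and by (R2)∕(R1d) (K2E3-p11 (g4)).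
* §1 (K2E3-p11 (g4), any Hausdorff topological field) the strata `{X² = 0} ⊆ {X³ = 0}` are closed, both orbits are LOCALLY CLOSED, `closure (Ad·J) ⊆ 𝒩`,
  `closure (Ad·E) ⊆ Ad·E ∪ {0}`;
* §2 one-orbit plumbing for ANY base point `X₀ : 𝔤`: the orbit is stable, so `val '' ((c • ·)⁻¹' s) = (Ad c)⁻¹' (val '' s)` (`image_val_preimage_smul`); the orbit
  action and `Ad` are continuous (`continuous_smul_orbit`, `continuous_conj`, `continuousSMul_conjAct`); both orbits are Borel sets and (over a non-archimedean
  local field) locally compact spaces;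
* §3 DOCKING: for a measure `Λ` on `𝔤` and `X₀ ∈ {J, E}`, the measure `val^* Λ := Measure.comap val Λ` on `↥(orbit G₃ X₀)` satisfies `(val^* Λ) s = Λ (val '' s)`, is
  finite on compacta if `Λ` is, is `G₃`-INVARIANT if `Λ` is `Ad(GL₃(F))`-invariant (`smulInvariantMeasure_comap_val_*`), is non-zero if `Λ(orbit) ≠ 0`, and
  `∫ f∘val d(val^* Λ) = ∫ f dΛ` if `Λ` is carried by the orbit — so the Richardson measures `Λ_P` of (R2) plug into (R1c) as `ν := val^* Λ_P`.
[HarishChandra1999AdmissibleDistributions, §3 pp. 8–10]; [BernsteinZelevinsky1976, §1.5, §1.18]; [Howe1974, §2].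

HONEST LABEL: HC_CM is proved only modulo the 7 printed citations (2 remaining named inputs: hLiu418 = stmt-HodgeConjecture-24832, h413 = stmt-HodgeConjecture-24833)
until rung 0 closes; count-neutral helper.

References: [HarishChandra1999AdmissibleDistributions] Harish-Chandra (DeBacker–Sally), AMS ULECT 16 (1999), §3 pp. 8–10, Thm. 3.9, Cor. 3.10 ·
[BernsteinZelevinsky1976] Russian Math. Surveys 31:3 (1976), §1.5, §1.18 · [Howe1974] R. Howe, Math. Ann. 208 (1974), §2.
-/

set_option autoImplicit false
set_option linter.dupNamespace false   -- `Summit.HodgeConjecture.HodgeConjecture.…` (D-0017 nested layout; lakefile exemption for Summits)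

noncomputable section

open MeasureTheory Measure Filter Topology TopologicalSpace
open scoped MatrixGroups NNReal ENNReal
open Literature.NumberTheory.GaloisRepresentations Literature.NumberTheory.GaloisRepresentations.IsNonarchimedeanLocalField
open Summit.HodgeConjecture.HodgeConjecture.Cruxes.H413.K2E3GL3NilpotentOrbits

namespace Summit.HodgeConjecture.HodgeConjecture.Cruxes.H413.K2E3GL3NilpotentOrbitSpaces

variable {F : Type*} [Field F]

/-! ## §1  Topology: both orbits are locally closed; the closure order `{0} < Ad·E₁₃ < Ad·J` (typed by K2E3-p11 (g4)) -/

section Topology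

variable [TopologicalSpace F] [IsTopologicalRing F] [T2Space F]

/-- `{X | X² = 0}` is closed in `𝔤𝔩₃(F)`. [folklore] -/
theorem isClosed_setOf_mul_self_eq_zero : IsClosed {X : Matrix (Fin 3) (Fin 3) F | X * X = 0} :=
  isClosed_eq (continuous_id.mul continuous_id) continuous_const

/-- The nilpotent cone `𝒩 = {X | X³ = 0}` is closed in `𝔤𝔩₃(F)`. [cite: HarishChandra1999AdmissibleDistributions, §3 p. 8] -/
theorem isClosed_setOf_pow_three_eq_zero : IsClosed {X : Matrix (Fin 3) (Fin 3) F | X ^ 3 = 0} :=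
  isClosed_eq (continuous_id.pow 3) continuous_const

/-- `{X | X² ≠ 0}` is open. [folklore] -/
theorem isOpen_setOf_mul_self_ne_zero : IsOpen {X : Matrix (Fin 3) (Fin 3) F | X * X ≠ 0} := by
  rw [show {X : Matrix (Fin 3) (Fin 3) F | X * X ≠ 0} = {X : Matrix (Fin 3) (Fin 3) F | X * X = 0}ᶜ from rfl]
  exact isClosed_setOf_mul_self_eq_zero.isOpen_compl

/-- **The regular orbit is locally closed** (`= 𝒩 ∩ {X² ≠ 0}`, closed ∩ open). [cite: HarishChandra1999AdmissibleDistributions, §3 p. 9] -/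
theorem isLocallyClosed_orbit_nilpReg :
    IsLocallyClosed (MulAction.orbit (ConjAct (GL (Fin 3) F)) (!![0, 1, 0; 0, 0, 1; 0, 0, 0] : Matrix (Fin 3) (Fin 3) F) : Set (Matrix (Fin 3) (Fin 3) F)) := by
  rw [orbit_nilpReg_eq]
  exact isClosed_setOf_pow_three_eq_zero.isLocallyClosed.inter isOpen_setOf_mul_self_ne_zero.isLocallyClosed

/-- **The minimal orbit is locally closed** (`= {X² = 0} ∩ {0}ᶜ`). [cite: HarishChandra1999AdmissibleDistributions, §3 p. 9] -/
theorem isLocallyClosed_orbit_nilpMin :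
    IsLocallyClosed (MulAction.orbit (ConjAct (GL (Fin 3) F)) (!![0, 0, 1; 0, 0, 0; 0, 0, 0] : Matrix (Fin 3) (Fin 3) F) : Set (Matrix (Fin 3) (Fin 3) F)) := by
  rw [orbit_nilpMin_eq]
  exact isClosed_setOf_mul_self_eq_zero.isLocallyClosed.inter isClosed_singleton.isOpen_compl.isLocallyClosed

/-- `closure (Ad·J) ⊆ 𝒩`. [cite: HarishChandra1999AdmissibleDistributions, §3 p. 9] -/
theorem closure_orbit_nilpReg_subset :
    closure (MulAction.orbit (ConjAct (GL (Fin 3) F)) (!![0, 1, 0; 0, 0, 1; 0, 0, 0] : Matrix (Fin 3) (Fin 3) F) : Set (Matrix (Fin 3) (Fin 3) F)) ⊆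
      {X | X ^ 3 = 0} := by
  refine closure_minimal ?_ isClosed_setOf_pow_three_eq_zero
  rw [orbit_nilpReg_eq]; exact Set.inter_subset_left

/-- `closure (Ad·E₁₃) ⊆ {X² = 0} = Ad·E₁₃ ∪ {0}`: the only orbit below the minimal one is `{0}`. [cite: HarishChandra1999AdmissibleDistributions, §3 p. 9] -/
theorem closure_orbit_nilpMin_subset :
    closure (MulAction.orbit (ConjAct (GL (Fin 3) F)) (!![0, 0, 1; 0, 0, 0; 0, 0, 0] : Matrix (Fin 3) (Fin 3) F) : Set (Matrix (Fin 3) (Fin 3) F)) ⊆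
      (MulAction.orbit (ConjAct (GL (Fin 3) F)) (!![0, 0, 1; 0, 0, 0; 0, 0, 0] : Matrix (Fin 3) (Fin 3) F) : Set (Matrix (Fin 3) (Fin 3) F)) ∪ {0} := by
  rw [← setOf_mul_self_eq_zero_eq]
  refine closure_minimal ?_ isClosed_setOf_mul_self_eq_zero
  rw [orbit_nilpMin_eq]; exact Set.inter_subset_left

end Topology

/-! ## §2  One-orbit plumbing: stability, continuity, measurability, local compactness -/

section Orbit

/-- **An orbit is stable**, so pre-images under the orbit action are read in `𝔤𝔩₃(F)`: for ANY base point `X₀` and `s ⊆ ↥(orbit G₃ X₀)`,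
`val '' ((c • ·)⁻¹' s) = (Ad c)⁻¹' (val '' s)` (the set identity behind the invariance of `val^* Λ`). [cite: BernsteinZelevinsky1976, §1.5] -/
theorem image_val_preimage_smul (X₀ : Matrix (Fin 3) (Fin 3) F) (c : ConjAct (GL (Fin 3) F)) (s : Set ↥(MulAction.orbit (ConjAct (GL (Fin 3) F)) X₀)) :
    Subtype.val '' ((fun x : ↥(MulAction.orbit (ConjAct (GL (Fin 3) F)) X₀) => c • x) ⁻¹' s) =
      (fun Y : Matrix (Fin 3) (Fin 3) F => ((ConjAct.ofConjAct c : GL (Fin 3) F) : Matrix (Fin 3) (Fin 3) F) * Y *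
        (((ConjAct.ofConjAct c)⁻¹ : GL (Fin 3) F) : Matrix (Fin 3) (Fin 3) F)) ⁻¹' (Subtype.val '' s) := by
  ext Y
  simp only [Set.mem_image, Set.mem_preimage]
  constructor
  · rintro ⟨x, hx, rfl⟩
    refine ⟨c • x, hx, ?_⟩
    rw [MulAction.orbit.coe_smul, ConjAct.units_smul_def]
  · rintro ⟨x', hx', hY⟩
    rw [← ConjAct.units_smul_def] at hY
    have hYmem : Y ∈ MulAction.orbit (ConjAct (GL (Fin 3) F)) X₀ := by
      have hY' : Y = c⁻¹ • (x' : Matrix (Fin 3) (Fin 3) F) := by rw [hY, inv_smul_smul]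
      rw [hY', ← MulAction.orbit.coe_smul]
      exact (c⁻¹ • x').2
    refine ⟨⟨Y, hYmem⟩, ?_, rfl⟩
    have hx : c • (⟨Y, hYmem⟩ : ↥(MulAction.orbit (ConjAct (GL (Fin 3) F)) X₀)) = x' := Subtype.ext (by rw [MulAction.orbit.coe_smul, ← hY])
    rw [hx]
    exact hx'

variable [TopologicalSpace F] [IsTopologicalRing F]

/-- `Ad(g) : Y ↦ g Y g⁻¹` is continuous on `𝔤𝔩₃(F)`. [folklore] -/
theorem continuous_conj (g : GL (Fin 3) F) :
    Continuous fun Y : Matrix (Fin 3) (Fin 3) F => (g : Matrix (Fin 3) (Fin 3) F) * Y * ((g⁻¹ : GL (Fin 3) F) : Matrix (Fin 3) (Fin 3) F) :=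
  (continuous_const.mul continuous_id).mul continuous_const

/-- The orbit action `x ↦ c • x` on `↥(orbit G₃ X₀)` is continuous (it is `Y ↦ c Y c⁻¹` under `val`). [cite: BernsteinZelevinsky1976, §1.5] -/
theorem continuous_smul_orbit (X₀ : Matrix (Fin 3) (Fin 3) F) (c : ConjAct (GL (Fin 3) F)) :
    Continuous fun x : ↥(MulAction.orbit (ConjAct (GL (Fin 3) F)) X₀) => c • x := by
  have h : Continuous fun x : ↥(MulAction.orbit (ConjAct (GL (Fin 3) F)) X₀) => c • (x : Matrix (Fin 3) (Fin 3) F) :=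
    (continuous_const_smul c).comp continuous_subtype_val
  exact h.subtype_mk _

/-- **`G₃ = ConjAct GL₃(F)` (topologised as `GL₃(F)`) acts continuously on `𝔤𝔩₃(F)`** — joint continuity of `(g, Y) ↦ g Y g⁻¹`; stated for the topology on the
synonym `ConjAct (GL (Fin 3) F)` transported from `GL (Fin 3) F` (as the consumer sets it up with `letI`). [cite: BernsteinZelevinsky1976, §1.5] -/
theorem continuousSMul_conjAct :
    @ContinuousSMul (ConjAct (GL (Fin 3) F)) (Matrix (Fin 3) (Fin 3) F) _ (inferInstance : TopologicalSpace (GL (Fin 3) F)) _ := by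
  letI : TopologicalSpace (ConjAct (GL (Fin 3) F)) := (inferInstance : TopologicalSpace (GL (Fin 3) F))
  refine ⟨?_⟩
  have hc1 : Continuous fun p : ConjAct (GL (Fin 3) F) × Matrix (Fin 3) (Fin 3) F =>
      ((ConjAct.ofConjAct p.1 : GL (Fin 3) F) : Matrix (Fin 3) (Fin 3) F) := Units.continuous_val.comp continuous_fst
  have hc3 : Continuous fun p : ConjAct (GL (Fin 3) F) × Matrix (Fin 3) (Fin 3) F =>
      (((ConjAct.ofConjAct p.1)⁻¹ : GL (Fin 3) F) : Matrix (Fin 3) (Fin 3) F) := Units.continuous_coe_inv.comp continuous_fst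
  exact (hc1.mul continuous_snd).mul hc3

variable [T2Space F]

/-- The regular orbit is a Borel set. [cite: BernsteinZelevinsky1976, §1.5] -/
theorem measurableSet_orbit_nilpReg [MeasurableSpace (Matrix (Fin 3) (Fin 3) F)] [OpensMeasurableSpace (Matrix (Fin 3) (Fin 3) F)] :
    MeasurableSet (MulAction.orbit (ConjAct (GL (Fin 3) F)) (!![0, 1, 0; 0, 0, 1; 0, 0, 0] : Matrix (Fin 3) (Fin 3) F)) := by
  rw [orbit_nilpReg_eq]
  exact isClosed_setOf_pow_three_eq_zero.measurableSet.inter isOpen_setOf_mul_self_ne_zero.measurableSet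

/-- The minimal orbit is a Borel set. [cite: BernsteinZelevinsky1976, §1.5] -/
theorem measurableSet_orbit_nilpMin [MeasurableSpace (Matrix (Fin 3) (Fin 3) F)] [OpensMeasurableSpace (Matrix (Fin 3) (Fin 3) F)] :
    MeasurableSet (MulAction.orbit (ConjAct (GL (Fin 3) F)) (!![0, 0, 1; 0, 0, 0; 0, 0, 0] : Matrix (Fin 3) (Fin 3) F)) := by
  rw [orbit_nilpMin_eq]
  exact isClosed_setOf_mul_self_eq_zero.measurableSet.inter isClosed_singleton.isOpen_compl.measurableSet

end Orbit

section LocalField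

variable [ValuativeRel F] [TopologicalSpace F] [IsNonarchimedeanLocalField F]

/-- The regular orbit `↥(Ad·J)` is locally compact (locally closed in the locally compact `𝔤𝔩₃(F)`), hence a Baire space. [cite: BernsteinZelevinsky1976, §1.5] -/
theorem locallyCompactSpace_orbit_nilpReg :
    LocallyCompactSpace ↥(MulAction.orbit (ConjAct (GL (Fin 3) F)) (!![0, 1, 0; 0, 0, 1; 0, 0, 0] : Matrix (Fin 3) (Fin 3) F)) := by
  haveI : T2Space F := (isLocalField F).toT2Space
  haveI : LocallyCompactSpace F := (isLocalField F).toLocallyCompactSpace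
  haveI : LocallyCompactSpace (Matrix (Fin 3) (Fin 3) F) := Pi.locallyCompactSpace_of_finite
  exact (isLocallyClosed_orbit_nilpReg (F := F)).locallyCompactSpace

/-- The minimal orbit `↥(Ad·E₁₃)` is locally compact, hence a Baire space. [cite: BernsteinZelevinsky1976, §1.5] -/
theorem locallyCompactSpace_orbit_nilpMin :
    LocallyCompactSpace ↥(MulAction.orbit (ConjAct (GL (Fin 3) F)) (!![0, 0, 1; 0, 0, 0; 0, 0, 0] : Matrix (Fin 3) (Fin 3) F)) := by
  haveI : T2Space F := (isLocalField F).toT2Space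
  haveI : LocallyCompactSpace F := (isLocalField F).toLocallyCompactSpace
  haveI : LocallyCompactSpace (Matrix (Fin 3) (Fin 3) F) := Pi.locallyCompactSpace_of_finite
  exact (isLocallyClosed_orbit_nilpMin (F := F)).locallyCompactSpace

end LocalField

/-! ## §3  Docking of an ambient measure `Λ` on `𝔤𝔩₃(F)`: the measure `val^* Λ` on an orbit -/

section Docking

variable [TopologicalSpace F] [IsTopologicalRing F] [MeasurableSpace (Matrix (Fin 3) (Fin 3) F)] [BorelSpace (Matrix (Fin 3) (Fin 3) F)]
  {X₀ : Matrix (Fin 3) (Fin 3) F} (hO : MeasurableSet (MulAction.orbit (ConjAct (GL (Fin 3) F)) X₀)) (Λ : Measure (Matrix (Fin 3) (Fin 3) F))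

include hO

omit [TopologicalSpace F] [IsTopologicalRing F] [BorelSpace (Matrix (Fin 3) (Fin 3) F)] in
/-- `(val^* Λ) s = Λ (val '' s)` for every `s ⊆ ↥(orbit)` (the orbit is measurable, `val` a measurable embedding). [cite: BernsteinZelevinsky1976, §1.18] -/
theorem comap_val_apply (s : Set ↥(MulAction.orbit (ConjAct (GL (Fin 3) F)) X₀)) :
    (Measure.comap (Subtype.val : ↥(MulAction.orbit (ConjAct (GL (Fin 3) F)) X₀) → Matrix (Fin 3) (Fin 3) F) Λ) s = Λ (Subtype.val '' s) :=
  comap_subtype_coe_apply hO Λ s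

omit [IsTopologicalRing F] [BorelSpace (Matrix (Fin 3) (Fin 3) F)] in
/-- **`val^* Λ` is finite on compact sets** if `Λ` is. [cite: HarishChandra1999AdmissibleDistributions, §3 p. 9] -/
theorem isFiniteMeasureOnCompacts_comap_val [IsFiniteMeasureOnCompacts Λ] :
    IsFiniteMeasureOnCompacts (Measure.comap (Subtype.val : ↥(MulAction.orbit (ConjAct (GL (Fin 3) F)) X₀) → Matrix (Fin 3) (Fin 3) F) Λ) := by
  refine ⟨fun K hK => ?_⟩
  rw [comap_val_apply hO]
  exact (hK.image continuous_subtype_val).measure_lt_top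

/-- **`val^* Λ` is `G₃`-invariant if `Λ` is `Ad(GL₃(F))`-invariant** (`Ad(g)_* Λ = Λ` for all `g`, and `val '' ((g • ·)⁻¹' s) = (Ad g)⁻¹' (val '' s)`).
[cite: HarishChandra1999AdmissibleDistributions, §3 pp. 8–10] [cite: BernsteinZelevinsky1976, §1.18] -/
theorem smulInvariantMeasure_comap_val
    (hΛ : ∀ g : GL (Fin 3) F, Λ.map (fun Y : Matrix (Fin 3) (Fin 3) F => (g : Matrix (Fin 3) (Fin 3) F) * Y * ((g⁻¹ : GL (Fin 3) F) : Matrix (Fin 3) (Fin 3) F)) = Λ) :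
    SMulInvariantMeasure (ConjAct (GL (Fin 3) F)) ↥(MulAction.orbit (ConjAct (GL (Fin 3) F)) X₀)
      (Measure.comap (Subtype.val : ↥(MulAction.orbit (ConjAct (GL (Fin 3) F)) X₀) → Matrix (Fin 3) (Fin 3) F) Λ) := by
  refine ⟨fun c s hs => ?_⟩
  have hAd : Measurable fun Y : Matrix (Fin 3) (Fin 3) F => ((ConjAct.ofConjAct c : GL (Fin 3) F) : Matrix (Fin 3) (Fin 3) F) * Y *
      (((ConjAct.ofConjAct c)⁻¹ : GL (Fin 3) F) : Matrix (Fin 3) (Fin 3) F) := (continuous_conj (ConjAct.ofConjAct c)).measurable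
  rw [comap_val_apply hO, comap_val_apply hO, image_val_preimage_smul, ← Measure.map_apply hAd (hO.subtype_image hs), hΛ (ConjAct.ofConjAct c)]

omit [TopologicalSpace F] [IsTopologicalRing F] [BorelSpace (Matrix (Fin 3) (Fin 3) F)] in
/-- The same from POINTWISE `Ad`-invariance on measurable sets: `Λ ((Ad g)⁻¹' A) = Λ A`. [cite: BernsteinZelevinsky1976, §1.18] -/
theorem smulInvariantMeasure_comap_val_of_preimage
    (hΛ : ∀ (g : GL (Fin 3) F) (A : Set (Matrix (Fin 3) (Fin 3) F)), MeasurableSet A →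
      Λ ((fun Y : Matrix (Fin 3) (Fin 3) F => (g : Matrix (Fin 3) (Fin 3) F) * Y * ((g⁻¹ : GL (Fin 3) F) : Matrix (Fin 3) (Fin 3) F)) ⁻¹' A) = Λ A) :
    SMulInvariantMeasure (ConjAct (GL (Fin 3) F)) ↥(MulAction.orbit (ConjAct (GL (Fin 3) F)) X₀)
      (Measure.comap (Subtype.val : ↥(MulAction.orbit (ConjAct (GL (Fin 3) F)) X₀) → Matrix (Fin 3) (Fin 3) F) Λ) := by
  refine ⟨fun c s hs => ?_⟩
  rw [comap_val_apply hO, comap_val_apply hO, image_val_preimage_smul, hΛ (ConjAct.ofConjAct c) _ (hO.subtype_image hs)]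

omit [TopologicalSpace F] [IsTopologicalRing F] [BorelSpace (Matrix (Fin 3) (Fin 3) F)] in
/-- **`val^* Λ ≠ 0` if `Λ` charges the orbit.** [cite: HarishChandra1999AdmissibleDistributions, §3 p. 9] -/
theorem comap_val_ne_zero (h : Λ (MulAction.orbit (ConjAct (GL (Fin 3) F)) X₀) ≠ 0) :
    Measure.comap (Subtype.val : ↥(MulAction.orbit (ConjAct (GL (Fin 3) F)) X₀) → Matrix (Fin 3) (Fin 3) F) Λ ≠ 0 := by
  intro h0
  have h1 := comap_val_apply hO Λ Set.univ
  rw [h0, Measure.coe_zero, Pi.zero_apply, Set.image_univ, Subtype.range_coe] at h1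
  exact h h1.symm

omit [TopologicalSpace F] [IsTopologicalRing F] [BorelSpace (Matrix (Fin 3) (Fin 3) F)] in
/-- **Total mass**: `(val^* Λ)(univ) = Λ(orbit)`. [cite: BernsteinZelevinsky1976, §1.18] -/
theorem comap_val_univ :
    (Measure.comap (Subtype.val : ↥(MulAction.orbit (ConjAct (GL (Fin 3) F)) X₀) → Matrix (Fin 3) (Fin 3) F) Λ) Set.univ =
      Λ (MulAction.orbit (ConjAct (GL (Fin 3) F)) X₀) := by
  rw [comap_val_apply hO, Set.image_univ, Subtype.range_coe]

omit [TopologicalSpace F] [IsTopologicalRing F] [BorelSpace (Matrix (Fin 3) (Fin 3) F)] in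
/-- **Integration on the orbit**: if `Λ` is carried by the orbit (`Λ(orbitᶜ) = 0`), then `∫_X f(val x) d(val^* Λ) = ∫ f dΛ` — e.g. `Λ = Λ_P` a Richardson measure
and `f ↦ ∫ f dΛ_P` the corresponding nilpotent orbital integral. [cite: HarishChandra1999AdmissibleDistributions, §3 p. 9] [cite: BernsteinZelevinsky1976, §1.18] -/
theorem integral_comp_val_comap_val (h0 : Λ (MulAction.orbit (ConjAct (GL (Fin 3) F)) X₀)ᶜ = 0) {B : Type*} [NormedAddCommGroup B] [NormedSpace ℝ B]
    (f : Matrix (Fin 3) (Fin 3) F → B) :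
    ∫ x : ↥(MulAction.orbit (ConjAct (GL (Fin 3) F)) X₀), f (x : Matrix (Fin 3) (Fin 3) F)
        ∂(Measure.comap (Subtype.val : ↥(MulAction.orbit (ConjAct (GL (Fin 3) F)) X₀) → Matrix (Fin 3) (Fin 3) F) Λ) = ∫ X, f X ∂Λ := by
  have hae : ∀ᵐ X ∂Λ, X ∈ MulAction.orbit (ConjAct (GL (Fin 3) F)) X₀ := mem_ae_iff.2 h0
  rw [integral_subtype_comap hO, Measure.restrict_eq_self_of_ae_mem hae]

end Docking

end Summit.HodgeConjecture.HodgeConjecture.Cruxes.H413.K2E3GL3NilpotentOrbitSpaces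

end
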